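import Literature.NumberTheory.Rogawski1990.FinExplicitTransferFactorLeviStratum
import Literature.NumberTheory.Rogawski1990.UnitFundamentalLemmaInertResiduallyRegularExplicit
import Literature.NumberTheory.Automorphic.UnitaryGroupLineUnipotentRing
import HarnessLib

/-!
# [Rogawski1990 §4.9 Prop. 4.9.1 (b)] The unit fundamental lemma at an INERT place on the LEVI (split-torus) stratum, per `γ_H` — the clause of
# (4.3.1) at the units for `γ_H = (diag(d′₀, d′₁), u)` integral and `(G,H)`-regular, over the `H`-side module binder
(Rogawski (1990), §4.9 Prop. 4.9.1 (b) and (4.9.2) p. 55 «`Φ(γ, 1_K) = |D(γ)|⁻¹ (1_K)^{(B)}(γ)`»; §4.3 (4.3.1) p. 43; §3.5 Prop. 3.5.2 p. 29; Kottwitz (1986) §7)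

Topic `NumberTheory/Rogawski1990`; namespace `Literature.NumberTheory.Rogawski1990`.  THEOREMS ONLY (no definition, no instance, no notation, no named fact, no
`sorry`).  Cell `pub/hodgecm-mathlib`, F0∕P3a, road «D-N7-inert» (A-p06 MAP v2 f057cb56 §1 row L8 (P2)), brick «JUNCTION-Levi» FILE F = THE CLAUSE (LEAD F0P3a-plan (g9)
T8-20 (D)(1); cut-holder F0P3b-p01 (g6)).  HC_CM is proved only modulo the 2 remaining named inputs (hLiu418, h413) until rung 0 closes; this file proves none.

THE STATEMENT.  At a non-split place `w ∣ v` of the CM field `L` (`c • w = w`), unramified, of good reduction for `H′` (`H′_w ∈ GL₃(𝒪_w)`), with canonical `mG`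
(`νG(K′) = 1`), let `γ_H = (g, u) ∈ H_v` lie on the LEVI STRATUM in `H`-coordinates: `g = diag(d′₀, d′₁) ∈ U(Φ₂)(L⁺_v)` and `γ_H ∈ K_H` (so
`ι_v(γ_H) = t = diag(d′₀, u, d′₁) ∈ T(𝒪_v)`), `(G,H)`-REGULAR (`d′₀⁻¹u − 1`, `d′₀⁻¹d′₁ − 1`, `d′₁ − u` units; `ι_v(γ_H)` regular).  Then for ANY local transfer factor
`T` whose value on the integral matches of `γ_H` is `‖d′₀⁻¹u − 1‖` (binder `hΔ`; discharged for Rogawski's `Δ‴_v` by ★ `finExplicitDelta_eq_unitModulusChar_of_levi_of_nonsplit`)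
and ANY family `mH` whose unit orbital integral at `γ_H` is the rank-one module `(√‖d′₀⁻¹d′₁ − 1‖)⁻¹` (binder `hΦH`, the `H`-side value of (4.9.2) — B-p12's
«(L8b)-H» head), the clause of ★ `isLocalDeltaTransfer_iff` at `f^H = 1_{K_H}`, `f = 1_{K′}` holds at `γ_H`:
`Φ^st(γ_H, 1_{K_H}) = ∑ᶠ c, Δ(γ_H, out c) · Φ(c, 1_{K′})`.
PROOF = ★ `stableOrbitalIntegralRel_indicator_eq_finsum_delta_iff_of_unique` with: `huniqH` — the `H`-stable class of `γ_H` meets `H_v` in ONE class (★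
`isConj_of_isStablyConj_of_splitFrame_two` on `U(Φ₂)`, frame `P = 1`, unit conditions from the torus relations ★ `LineRing.torus_relations_two`; `U(Φ₁)` abelian);
`huniqG` — ★ `isConj_of_isLocalNormPair_of_isLocalNormPair_of_levi` (`𝔇(T_G) = 1`); the `G`-side value ★ `exists_classOrbitalIntegral_indicator_eq_twist_of_torus_regular_of_nonsplit`
(`Φ(⟦γ₀⟧, 1_{K′}) = (‖a − 1‖·√‖b − 1‖)⁻¹`, ★ `twistModule_cmLocal_eq`) at the integral match `γ₀ = ψ⁻¹(t) ∈ K′`; and `‖a − 1‖ · (‖a − 1‖ · √‖b − 1‖)⁻¹ = (√‖b − 1‖)⁻¹`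
(`b = d′₀⁻¹d′₁` on both sides).  NOT here: the `H`-side value itself (B-p12 (g28) «(L8b)-H» C′), the transport to `γ_H` stably conjugate INTO the stratum (★
`UnitFundamentalLemmaInertVanishing` pattern), the assembly (F0P3a-p04 (N4) ED. 2).

## References
* [Rogawski1990] J. D. Rogawski, *Automorphic Representations of Unitary Groups in Three Variables*, Ann. of Math. Stud. 123 (1990): §4.9 Prop. 4.9.1 (b), (4.9.2)
  p. 55; §4.3 (4.3.1) p. 43; §3.5 Prop. 3.5.2 p. 29; §4.1 (4.1.1) p. 39.
* [Kottwitz1986] R. E. Kottwitz, *Base change for unit elements of Hecke algebras*, Compositio Math. 60 (1986): §7.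
-/

set_option autoImplicit false

noncomputable section

open MeasureTheory Measure Set NumberField IsDedekindDomain Matrix
open Literature.NumberTheory.Automorphic Literature.NumberTheory.Automorphic.UnitaryGroup
open Literature.NumberTheory.GaloisRepresentations
open scoped NNReal Matrix MatrixGroups

namespace Literature.NumberTheory.Rogawski1990

/-- **`H`-SIDE UNIQUENESS ON THE LEVI STRATUM**: for `γ_H = (diag(d′₀, d′₁), u) ∈ H_v = U(Φ₂)(L⁺_v) × U(Φ₁)(L⁺_v)` with `d′₀ − d′₁` a unit, every `k ∈ H_v`
stably conjugate to `γ_H` (★ `IsLocalStablyConjH`: componentwise `GL`-conjugacy) is conjugate to `γ_H` IN `H_v` — on `U(Φ₂)` by ★ `isConj_of_isStablyConj_of_splitFrame_two`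
(frame `P = 1`; `σ(d′₀)d′₀ − 1`, `σ(d′₁)d′₁ − 1` units by the torus relations `σ(d′₁)d′₀ = σ(d′₀)d′₁ = 1`, ★ `LineRing.torus_relations_two`), on the abelian `U(Φ₁)`
trivially.  The `huniqH` binder of ★ `stableOrbitalIntegralRel_indicator_eq_classOrbitalIntegral_of_unique` (no integrality needed). [cite: Rogawski1990, §3.5 Prop. 3.5.2 p. 29;
§3.6 p. 31] -/
theorem isConj_of_isLocalStablyConjH_of_levi (L : Type) [Field L] [NumberField L] [IsCMField L] {v : HeightOneSpectrum (𝓞 ↥(maximalRealSubfield L))}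
    {γH k : (cmDatum L 2 (Matrix.of fun i j : Fin 2 => if i.val + j.val + 1 = 2 then (1 : L) else 0)).Local v ×
      (cmDatum L 1 (Matrix.of fun i j : Fin 1 => if i.val + j.val + 1 = 1 then (1 : L) else 0)).Local v}
    {d' : Fin 2 → (UnitaryGroup.LocalRing L v)ˣ} (hd' : glDiagonal 2 (UnitaryGroup.LocalRing L v) d' = (γH.1.val : GL (Fin 2) (UnitaryGroup.LocalRing L v)))
    (h01 : IsUnit ((d' 0 : UnitaryGroup.LocalRing L v) - d' 1)) (hst : IsLocalStablyConjH L v γH k) : IsConj γH k := by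
  have ht : γH.1 ∈ torusU (conjLocal L (IsCMField.complexConj L) v) (cmLocalForm L 2 v) := ⟨d', hd'⟩
  obtain ⟨h10, h01'⟩ := LineRing.torus_relations_two (conjLocal L (IsCMField.complexConj L) v) (cmLocalForm_eq_over L 2 v) ⟨_, ht⟩ hd'
  -- `U(Φ₂)`-component: one class by the split frame `P = 1`
  have hP : γH.1.val.val * (1 : GL (Fin 2) (UnitaryGroup.LocalRing L v)).val =
      (1 : GL (Fin 2) (UnitaryGroup.LocalRing L v)).val * Matrix.diagonal fun k => (d' k : UnitaryGroup.LocalRing L v) := by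
    rw [Units.val_one, Matrix.mul_one, Matrix.one_mul, ← coe_glDiagonal, hd']
  have hu0 : IsUnit (conjLocal L (IsCMField.complexConj L) v (d' 0 : UnitaryGroup.LocalRing L v) * d' 0 - 1) := by
    have hσ : conjLocal L (IsCMField.complexConj L) v (d' 0 : UnitaryGroup.LocalRing L v) = (((d' 1)⁻¹ : (UnitaryGroup.LocalRing L v)ˣ) : _) := by
      rw [← mul_one (conjLocal L _ v (d' 0 : UnitaryGroup.LocalRing L v)), ← Units.mul_inv (d' 1), ← mul_assoc, h01', one_mul]
    rw [hσ, show (((d' 1)⁻¹ : (UnitaryGroup.LocalRing L v)ˣ) : UnitaryGroup.LocalRing L v) * d' 0 - 1 =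
      (((d' 1)⁻¹ : (UnitaryGroup.LocalRing L v)ˣ) : UnitaryGroup.LocalRing L v) * ((d' 0 : UnitaryGroup.LocalRing L v) - d' 1) by
        rw [mul_sub, Units.inv_mul]]
    exact (Units.isUnit _).mul h01
  have hu1 : IsUnit (conjLocal L (IsCMField.complexConj L) v (d' 1 : UnitaryGroup.LocalRing L v) * d' 1 - 1) := by
    have hσ : conjLocal L (IsCMField.complexConj L) v (d' 1 : UnitaryGroup.LocalRing L v) = (((d' 0)⁻¹ : (UnitaryGroup.LocalRing L v)ˣ) : _) := by
      rw [← mul_one (conjLocal L _ v (d' 1 : UnitaryGroup.LocalRing L v)), ← Units.mul_inv (d' 0), ← mul_assoc, h10, one_mul]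
    rw [hσ, show (((d' 0)⁻¹ : (UnitaryGroup.LocalRing L v)ˣ) : UnitaryGroup.LocalRing L v) * d' 1 - 1 =
      (((d' 0)⁻¹ : (UnitaryGroup.LocalRing L v)ˣ) : UnitaryGroup.LocalRing L v) * -((d' 0 : UnitaryGroup.LocalRing L v) - d' 1) by
        rw [neg_sub, mul_sub, Units.inv_mul]]
    exact (Units.isUnit _).mul h01.neg
  have h2 : IsConj γH.1 k.1 :=
    isConj_of_isStablyConj_of_splitFrame_two (conjLocal L (IsCMField.complexConj L) v) _ (conjLocal_conjLocal_cm L v)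
      (map_conjLocal_transpose_localForm L 2 _ v (antidiagOne_isHermitian L 2))
      (isUnit_det_localForm L 2 _ v (isUnit_antidiagOne_det L 2).ne_zero) hst.1 1 hP hu0 hu1
  -- `U(Φ₁)`-component: `GL₁` of a commutative ring — conjugate elements are equal
  have h1 : γH.2 = k.2 := by
    obtain ⟨c, hc⟩ := isConj_iff.1 hst.2
    have hcc : c.val 0 0 * (c⁻¹).val 0 0 = 1 := by
      have h := congrArg (fun g : GL (Fin 1) (UnitaryGroup.LocalRing L v) => g.val 0 0) (mul_inv_cancel c)
      simpa only [Units.val_mul, Matrix.mul_apply, Fin.sum_univ_one, Units.val_one, Matrix.one_apply_eq] using h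
    have h := congrArg (fun g : GL (Fin 1) (UnitaryGroup.LocalRing L v) => g.val 0 0) hc
    simp only [Units.val_mul, Matrix.mul_apply, Fin.sum_univ_one] at h
    refine Subtype.ext (Units.ext (Matrix.ext fun i j => ?_))
    fin_cases i; fin_cases j
    show γH.2.val.val 0 0 = k.2.val.val 0 0
    rw [← h, mul_comm (c.val 0 0), mul_assoc, hcc, mul_one]
  obtain ⟨c₂, hc₂⟩ := isConj_iff.1 h2
  exact isConj_iff.2 ⟨(c₂, 1), Prod.ext hc₂ (by rw [← h1]; simp)⟩

/-- **Regularity of `diag(d′₀, u, d′₁)` from the three Levi-stratum units**: `d′₀⁻¹u − 1`, `d′₀⁻¹d′₁ − 1`, `u − d′₁ ∈ R^×` give `dᵢ − dⱼ ∈ R^×` for all `i ≠ j`,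
`d = (d′₀, u, d′₁)` (★ `HeisRing.isUnit_coe_inv_mul_sub_one_iff`). [cite: Rogawski1990, §4.9 p. 55] -/
theorem isUnit_vecCons_sub_of_levi {R : Type*} [CommRing R] {d' : Fin 2 → Rˣ} {u : Rˣ} (ha : IsUnit ((((d' 0)⁻¹ * u : Rˣ) : R) - 1))
    (hb : IsUnit ((((d' 0)⁻¹ * d' 1 : Rˣ) : R) - 1)) (h12 : IsUnit ((u : R) - d' 1)) :
    ∀ i j : Fin 3, i ≠ j → IsUnit (((![d' 0, u, d' 1] i : Rˣ) : R) - ![d' 0, u, d' 1] j) := by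
  have e10 : IsUnit ((u : R) - d' 0) := (HeisRing.isUnit_coe_inv_mul_sub_one_iff ![d' 0, u, d' 1] 0 1).1 ha
  have e20 : IsUnit ((d' 1 : R) - d' 0) := (HeisRing.isUnit_coe_inv_mul_sub_one_iff ![d' 0, u, d' 1] 0 2).1 hb
  have e21 : IsUnit ((d' 1 : R) - u) := by rw [← neg_sub]; exact h12.neg
  intro i j hij
  fin_cases i <;> fin_cases j
  · exact absurd rfl hij
  · simpa using e10.neg
  · simpa using e20.neg
  · simpa using e10
  · exact absurd rfl hij
  · simpa using e21.neg
  · simpa using e20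
  · simpa using e21
  · exact absurd rfl hij

/-- **THE UNIT FUNDAMENTAL LEMMA ON THE LEVI STRATUM AT A NON-SPLIT PLACE, PER `γ_H`, OVER THE `H`-SIDE MODULE.**  At a finite place `v` of `L⁺` non-split
(`c • w = w`) and unramified in `L`, of good reduction for `H′`, with a canonical family `mG` on `U(H′)(L⁺_v)` (`νG(K′) = 1`): let `γ_H = (g, u) ∈ K_H` with
`g = diag(d′₀, d′₁)` (`glDiagonal 2 _ d′ = g`), `G`-regular, with `d′₀⁻¹u − 1`, `d′₀⁻¹d′₁ − 1`, `u − d′₁` units.  For ANY local transfer factor `T` taking the value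
`‖d′₀⁻¹u − 1‖` at the integral matches of `γ_H` (`hΔ`; for Rogawski's `Δ‴_v` this is ★ `finExplicitDelta_eq_unitModulusChar_of_levi_of_nonsplit`) and ANY family `mH` on `H_v`
with `Φ(⟦γ_H⟧, 1_{K_H}) = (√‖d′₀⁻¹d′₁ − 1‖)⁻¹` (`hΦH`, the `H`-side of (4.9.2)): **`Φ^st(γ_H, 1_{K_H}) = ∑ᶠ c, Δ(γ_H, out c) · Φ(c, 1_{K′})`** — the body of ★
`isLocalDeltaTransfer_iff` at `f^H = 1_{K_H}`, `f = 1_{K′}`.  Proof: ★ `stableOrbitalIntegralRel_indicator_eq_finsum_delta_iff_of_unique` with `huniqH` =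
`isConj_of_isLocalStablyConjH_of_levi`, `huniqG` = ★ `isConj_of_isLocalNormPair_of_isLocalNormPair_of_levi`, the `G`-side value ★
`exists_classOrbitalIntegral_indicator_eq_twist_of_torus_regular_of_nonsplit` `= (‖a − 1‖·√‖b − 1‖)⁻¹` (★ `twistModule_cmLocal_eq`) at the integral match `γ₀ ∈ K′`, and
`(√‖b − 1‖)⁻¹ = ‖a − 1‖ · (‖a − 1‖ · √‖b − 1‖)⁻¹`. [cite: Rogawski1990, §4.9 Prop. 4.9.1 (b), (4.9.2) p. 55; §4.3 (4.3.1) p. 43] [cite: Kottwitz1986, §7] -/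
theorem stableOrbitalIntegralRel_indicator_eq_finsum_delta_of_levi_of_nonsplit
    (L : Type) [Field L] [NumberField L] [IsCMField L] (H' : Matrix (Fin 3) (Fin 3) L)
    (hH' : (H'.map (IsCMField.complexConj L))ᵀ = H') (hH'd : IsUnit H'.det)
    {v : HeightOneSpectrum (𝓞 ↥(maximalRealSubfield L))} (w : PlacesOver L v)
    (hw : IsCMField.complexConj L • w.1 = w.1) (hv : Algebra.IsUnramifiedIn (𝓞 L) v.asIdeal)
    (hH'w : IsUnit (placeForm H' w.1)) (hH'i : hH'w.unit ∈ glInt 3 (w.1.adicCompletion L))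
    [MeasurableSpace ((cmDatum L 3 H').Local v)] [BorelSpace ((cmDatum L 3 H').Local v)]
    [∀ γ : ((cmDatum L 3 H').Local v), MeasurableSpace (((cmDatum L 3 H').Local v) ⧸ Subgroup.centralizer ({γ} : Set ((cmDatum L 3 H').Local v)))]
    [∀ γ : ((cmDatum L 3 H').Local v), BorelSpace (((cmDatum L 3 H').Local v) ⧸ Subgroup.centralizer ({γ} : Set ((cmDatum L 3 H').Local v)))]
    [∀ a : ((cmDatum L 2 (Matrix.of fun i j : Fin 2 => if i.val + j.val + 1 = 2 then (1 : L) else 0)).Local v ×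
      (cmDatum L 1 (Matrix.of fun i j : Fin 1 => if i.val + j.val + 1 = 1 then (1 : L) else 0)).Local v),
      MeasurableSpace (((cmDatum L 2 (Matrix.of fun i j : Fin 2 => if i.val + j.val + 1 = 2 then (1 : L) else 0)).Local v ×
      (cmDatum L 1 (Matrix.of fun i j : Fin 1 => if i.val + j.val + 1 = 1 then (1 : L) else 0)).Local v) ⧸ Subgroup.centralizer ({a} : Set ((cmDatum L 2 (Matrix.of fun i j : Fin 2 => if i.val + j.val + 1 = 2 then (1 : L) else 0)).Local v ×
      (cmDatum L 1 (Matrix.of fun i j : Fin 1 => if i.val + j.val + 1 = 1 then (1 : L) else 0)).Local v)))]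
    (νG : Measure ((cmDatum L 3 H').Local v)) [νG.IsHaarMeasure] [νG.IsMulRightInvariant]
    (T : LocalTransferFactor L H' v)
    (mH : OrbitalMeasureFamily ((cmDatum L 2 (Matrix.of fun i j : Fin 2 => if i.val + j.val + 1 = 2 then (1 : L) else 0)).Local v ×
      (cmDatum L 1 (Matrix.of fun i j : Fin 1 => if i.val + j.val + 1 = 1 then (1 : L) else 0)).Local v)) {mG : OrbitalMeasureFamily ((cmDatum L 3 H').Local v)}
    (hmG : mG.IsCanonical (fun γ => IsRegularElt (γ.val : GL (Fin 3) (UnitaryGroup.LocalRing L v))) νG)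
    (hνG : νG (cmLocalIntegralLevel L 3 H' v : Set ((cmDatum L 3 H').Local v)) = 1)
    {γH : ((cmDatum L 2 (Matrix.of fun i j : Fin 2 => if i.val + j.val + 1 = 2 then (1 : L) else 0)).Local v ×
      (cmDatum L 1 (Matrix.of fun i j : Fin 1 => if i.val + j.val + 1 = 1 then (1 : L) else 0)).Local v)}
    {d' : Fin 2 → (UnitaryGroup.LocalRing L v)ˣ} (hd' : glDiagonal 2 (UnitaryGroup.LocalRing L v) d' = (γH.1.val : GL (Fin 2) (UnitaryGroup.LocalRing L v)))
    (hγH : γH ∈ ((cmLocalIntegralLevel L 2 (Matrix.of fun i j : Fin 2 => if i.val + j.val + 1 = 2 then (1 : L) else 0) v).prod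
      (cmLocalIntegralLevel L 1 (Matrix.of fun i j : Fin 1 => if i.val + j.val + 1 = 1 then (1 : L) else 0) v)))
    (hreg : IsLocalGRegular L v γH)
    (ha : IsUnit ((((d' 0)⁻¹ * (isUnit_finGammaTwo L v γH).unit : (UnitaryGroup.LocalRing L v)ˣ) : UnitaryGroup.LocalRing L v) - 1))
    (hb : IsUnit ((((d' 0)⁻¹ * d' 1 : (UnitaryGroup.LocalRing L v)ˣ) : UnitaryGroup.LocalRing L v) - 1))
    (h12 : IsUnit (finGammaTwo L v γH - (d' 1 : UnitaryGroup.LocalRing L v)))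
    (hΦH : classOrbitalIntegral mH ((((cmLocalIntegralLevel L 2 (Matrix.of fun i j : Fin 2 => if i.val + j.val + 1 = 2 then (1 : L) else 0) v).prod
      (cmLocalIntegralLevel L 1 (Matrix.of fun i j : Fin 1 => if i.val + j.val + 1 = 1 then (1 : L) else 0) v)) : Set ((cmDatum L 2 (Matrix.of fun i j : Fin 2 => if i.val + j.val + 1 = 2 then (1 : L) else 0)).Local v ×
      (cmDatum L 1 (Matrix.of fun i j : Fin 1 => if i.val + j.val + 1 = 1 then (1 : L) else 0)).Local v)).indicator fun _ => (1 : ℂ)) (ConjClasses.mk γH) =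
      ((((NNReal.sqrt (unitModulusChar (UnitaryGroup.LocalRing L v) hb.unit))⁻¹ : ℝ≥0) : ℝ) : ℂ))
    (hΔ : ∀ γ₀ : (cmDatum L 3 H').Local v, γ₀ ∈ cmLocalIntegralLevel L 3 H' v → IsLocalNormPair L H' v γH γ₀ →
      T.Δ γH γ₀ = (((unitModulusChar (UnitaryGroup.LocalRing L v) ha.unit : ℝ≥0) : ℝ) : ℂ)) :
    stableOrbitalIntegralRel (IsLocalStablyConjH L v) mH ((((cmLocalIntegralLevel L 2 (Matrix.of fun i j : Fin 2 => if i.val + j.val + 1 = 2 then (1 : L) else 0) v).prod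
      (cmLocalIntegralLevel L 1 (Matrix.of fun i j : Fin 1 => if i.val + j.val + 1 = 1 then (1 : L) else 0) v)) : Set ((cmDatum L 2 (Matrix.of fun i j : Fin 2 => if i.val + j.val + 1 = 2 then (1 : L) else 0)).Local v ×
      (cmDatum L 1 (Matrix.of fun i j : Fin 1 => if i.val + j.val + 1 = 1 then (1 : L) else 0)).Local v)).indicator fun _ => (1 : ℂ)) γH =
      ∑ᶠ c : ConjClasses ((cmDatum L 3 H').Local v), T.Δ γH (Quotient.out c) *
        classOrbitalIntegral mG ((cmLocalIntegralLevel L 3 H' v : Set ((cmDatum L 3 H').Local v)).indicator fun _ => (1 : ℂ)) c := by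
  -- the torus datum `ι_v(γ_H) = diag(d′₀, u, d′₁) ∈ T(𝒪_v)`, regular
  have hι := endoEmbLocal_eq_glDiagonal_of_fst_eq L v γH hd'
  have ht := endoEmbLocal_mem_torusU_of_endoEmbLocal_eq L v γH hι
  have hint := endoEmbLocal_mem_cmLocalIntegralLevel_of_nonsplit L w hw hγH
  have hu : (((isUnit_finGammaTwo L v γH).unit : (UnitaryGroup.LocalRing L v)ˣ) : UnitaryGroup.LocalRing L v) = finGammaTwo L v γH :=
    (isUnit_finGammaTwo L v γH).unit_spec
  have hreg3 := isUnit_vecCons_sub_of_levi ha hb (by rw [hu]; exact h12)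
  -- the `G`-side value at the integral match `γ₀ = ψ⁻¹(t) ∈ K′`
  obtain ⟨γ₀, hγ₀K, hconj, hG⟩ := exists_classOrbitalIntegral_indicator_eq_twist_of_torus_regular_of_nonsplit L H' hH' hH'd w hw hv hH'w hH'i νG hmG hνG
    ⟨_, ht⟩ hι.symm hreg3 hreg ha hb hint
  have h₀ : IsLocalNormPair L H' v γH γ₀ := hconj
  rw [twistModule_cmLocal_eq L v ht hι.symm ha hb] at hG
  -- the frame of ★ `UnitFundamentalLemmaInertResiduallyRegular` §1
  have hHC := isLocalStablyConjH_of_isConj_and_conj L γH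
  have h01 : IsUnit ((d' 0 : UnitaryGroup.LocalRing L v) - d' 1) := by simpa using hreg3 0 2 (by decide)
  refine (stableOrbitalIntegralRel_indicator_eq_finsum_delta_iff_of_unique (IsLocalStablyConjH L v) T mH mG _ _ γH γ₀ hHC.1 hHC.2
    (fun k _ hst => isConj_of_isLocalStablyConjH_of_levi L hd' h01 hst)
    (fun k _ hk' => isConj_of_isLocalNormPair_of_isLocalNormPair_of_levi L H' hH' hH'd γH hι hreg3 h₀ hk')).2 ?_
  rw [hΦH, hΔ γ₀ hγ₀K h₀, hG, ← Complex.ofReal_mul]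
  congr 1
  have hne : ((unitModulusChar (UnitaryGroup.LocalRing L v) ha.unit : ℝ≥0) : ℝ) ≠ 0 :=
    NNReal.coe_ne_zero.2 ((Group.isUnit ha.unit).map (unitModulusChar (UnitaryGroup.LocalRing L v))).ne_zero
  rw [NNReal.coe_inv, NNReal.coe_inv, NNReal.coe_mul, mul_inv]
  exact (mul_inv_cancel_left₀ hne _).symm

open scoped Classical in
/-- **THE SAME FOR ROGAWSKI'S EXPLICIT FACTOR `Δ‴_v` (★ `finExplicitCollection`)**: under the N7 μ-guard `μ|_{𝕀_{L⁺}} = ω_{L∕L⁺}` and `μ` unramified at `w`, the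
binder `hΔ` is ★ `finExplicitDelta_eq_unitModulusChar_of_levi_of_nonsplit` (`Δ‴_v(γ_H, γ₀) = ‖d′₀⁻¹u − 1‖` at every match), so on the Levi stratum the clause
`Φ^st(γ_H, 1_{K_H}) = ∑ᶠ c, Δ‴_v(γ_H, out c) · Φ(c, 1_{K′})` holds over the single `H`-side binder `hΦH` — population (P2) «`γ_H` non-elliptic, integral» of the
N7-inert assembly (★ `UnitFundamentalLemmaInertOffCount`), per `γ_H` in `H`-coordinates. [cite: Rogawski1990, §4.9 Prop. 4.9.1 (b), (4.9.2) p. 55; §4.3 (4.3.1) p. 43] -/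
theorem stableOrbitalIntegralRel_indicator_eq_finsum_finExplicitDelta_of_levi_of_nonsplit
    (L : Type) [Field L] [NumberField L] [IsCMField L] (H' : Matrix (Fin 3) (Fin 3) L)
    (hH' : (H'.map (IsCMField.complexConj L))ᵀ = H') (hH'd : IsUnit H'.det)
    {v : HeightOneSpectrum (𝓞 ↥(maximalRealSubfield L))} (w : PlacesOver L v)
    (hw : IsCMField.complexConj L • w.1 = w.1) (hv : Algebra.IsUnramifiedIn (𝓞 L) v.asIdeal)
    (hH'w : IsUnit (placeForm H' w.1)) (hH'i : hH'w.unit ∈ glInt 3 (w.1.adicCompletion L))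
    (μ : HeckeCharacter L) (hμ : μ.IsUnramifiedAt w.1)
    (hμω : ∀ x : ideleGroup ↥(maximalRealSubfield L), μ (AdeleRing.ideleBaseChange ↥(maximalRealSubfield L) L x) = quadraticHeckeCharCM L x)
    [MeasurableSpace ((cmDatum L 3 H').Local v)] [BorelSpace ((cmDatum L 3 H').Local v)]
    [∀ γ : ((cmDatum L 3 H').Local v), MeasurableSpace (((cmDatum L 3 H').Local v) ⧸ Subgroup.centralizer ({γ} : Set ((cmDatum L 3 H').Local v)))]
    [∀ γ : ((cmDatum L 3 H').Local v), BorelSpace (((cmDatum L 3 H').Local v) ⧸ Subgroup.centralizer ({γ} : Set ((cmDatum L 3 H').Local v)))]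
    [∀ a : ((cmDatum L 2 (Matrix.of fun i j : Fin 2 => if i.val + j.val + 1 = 2 then (1 : L) else 0)).Local v ×
      (cmDatum L 1 (Matrix.of fun i j : Fin 1 => if i.val + j.val + 1 = 1 then (1 : L) else 0)).Local v),
      MeasurableSpace (((cmDatum L 2 (Matrix.of fun i j : Fin 2 => if i.val + j.val + 1 = 2 then (1 : L) else 0)).Local v ×
      (cmDatum L 1 (Matrix.of fun i j : Fin 1 => if i.val + j.val + 1 = 1 then (1 : L) else 0)).Local v) ⧸ Subgroup.centralizer ({a} : Set ((cmDatum L 2 (Matrix.of fun i j : Fin 2 => if i.val + j.val + 1 = 2 then (1 : L) else 0)).Local v ×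
      (cmDatum L 1 (Matrix.of fun i j : Fin 1 => if i.val + j.val + 1 = 1 then (1 : L) else 0)).Local v)))]
    (νG : Measure ((cmDatum L 3 H').Local v)) [νG.IsHaarMeasure] [νG.IsMulRightInvariant]
    (hl : ∀ (v : HeightOneSpectrum (𝓞 ↥(maximalRealSubfield L))) (a : ((cmDatum L 2 (Matrix.of fun i j : Fin 2 => if i.val + j.val + 1 = 2 then (1 : L) else 0)).Local v ×
      (cmDatum L 1 (Matrix.of fun i j : Fin 1 => if i.val + j.val + 1 = 1 then (1 : L) else 0)).Local v)) (b : (cmDatum L 3 H').Local v) (x : ((cmDatum L 2 (Matrix.of fun i j : Fin 2 => if i.val + j.val + 1 = 2 then (1 : L) else 0)).Local v ×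
      (cmDatum L 1 (Matrix.of fun i j : Fin 1 => if i.val + j.val + 1 = 1 then (1 : L) else 0)).Local v)),
      finExplicitDelta L v H' (x * a * x⁻¹) μ b = finExplicitDelta L v H' a μ b)
    (hr : ∀ (v : HeightOneSpectrum (𝓞 ↥(maximalRealSubfield L))) (a : ((cmDatum L 2 (Matrix.of fun i j : Fin 2 => if i.val + j.val + 1 = 2 then (1 : L) else 0)).Local v ×
      (cmDatum L 1 (Matrix.of fun i j : Fin 1 => if i.val + j.val + 1 = 1 then (1 : L) else 0)).Local v)) (b y : (cmDatum L 3 H').Local v),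
      finExplicitDelta L v H' a μ (y * b * y⁻¹) = finExplicitDelta L v H' a μ b)
    (mH : OrbitalMeasureFamily ((cmDatum L 2 (Matrix.of fun i j : Fin 2 => if i.val + j.val + 1 = 2 then (1 : L) else 0)).Local v ×
      (cmDatum L 1 (Matrix.of fun i j : Fin 1 => if i.val + j.val + 1 = 1 then (1 : L) else 0)).Local v)) {mG : OrbitalMeasureFamily ((cmDatum L 3 H').Local v)}
    (hmG : mG.IsCanonical (fun γ => IsRegularElt (γ.val : GL (Fin 3) (UnitaryGroup.LocalRing L v))) νG)
    (hνG : νG (cmLocalIntegralLevel L 3 H' v : Set ((cmDatum L 3 H').Local v)) = 1)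
    {γH : ((cmDatum L 2 (Matrix.of fun i j : Fin 2 => if i.val + j.val + 1 = 2 then (1 : L) else 0)).Local v ×
      (cmDatum L 1 (Matrix.of fun i j : Fin 1 => if i.val + j.val + 1 = 1 then (1 : L) else 0)).Local v)}
    {d' : Fin 2 → (UnitaryGroup.LocalRing L v)ˣ} (hd' : glDiagonal 2 (UnitaryGroup.LocalRing L v) d' = (γH.1.val : GL (Fin 2) (UnitaryGroup.LocalRing L v)))
    (hγH : γH ∈ ((cmLocalIntegralLevel L 2 (Matrix.of fun i j : Fin 2 => if i.val + j.val + 1 = 2 then (1 : L) else 0) v).prod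
      (cmLocalIntegralLevel L 1 (Matrix.of fun i j : Fin 1 => if i.val + j.val + 1 = 1 then (1 : L) else 0) v)))
    (hreg : IsLocalGRegular L v γH)
    (ha : IsUnit ((((d' 0)⁻¹ * (isUnit_finGammaTwo L v γH).unit : (UnitaryGroup.LocalRing L v)ˣ) : UnitaryGroup.LocalRing L v) - 1))
    (hb : IsUnit ((((d' 0)⁻¹ * d' 1 : (UnitaryGroup.LocalRing L v)ˣ) : UnitaryGroup.LocalRing L v) - 1))
    (h12 : IsUnit (finGammaTwo L v γH - (d' 1 : UnitaryGroup.LocalRing L v)))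
    (hΦH : classOrbitalIntegral mH ((((cmLocalIntegralLevel L 2 (Matrix.of fun i j : Fin 2 => if i.val + j.val + 1 = 2 then (1 : L) else 0) v).prod
      (cmLocalIntegralLevel L 1 (Matrix.of fun i j : Fin 1 => if i.val + j.val + 1 = 1 then (1 : L) else 0) v)) : Set ((cmDatum L 2 (Matrix.of fun i j : Fin 2 => if i.val + j.val + 1 = 2 then (1 : L) else 0)).Local v ×
      (cmDatum L 1 (Matrix.of fun i j : Fin 1 => if i.val + j.val + 1 = 1 then (1 : L) else 0)).Local v)).indicator fun _ => (1 : ℂ)) (ConjClasses.mk γH) =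
      ((((NNReal.sqrt (unitModulusChar (UnitaryGroup.LocalRing L v) hb.unit))⁻¹ : ℝ≥0) : ℝ) : ℂ)) :
    stableOrbitalIntegralRel (IsLocalStablyConjH L v) mH ((((cmLocalIntegralLevel L 2 (Matrix.of fun i j : Fin 2 => if i.val + j.val + 1 = 2 then (1 : L) else 0) v).prod
      (cmLocalIntegralLevel L 1 (Matrix.of fun i j : Fin 1 => if i.val + j.val + 1 = 1 then (1 : L) else 0) v)) : Set ((cmDatum L 2 (Matrix.of fun i j : Fin 2 => if i.val + j.val + 1 = 2 then (1 : L) else 0)).Local v ×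
      (cmDatum L 1 (Matrix.of fun i j : Fin 1 => if i.val + j.val + 1 = 1 then (1 : L) else 0)).Local v)).indicator fun _ => (1 : ℂ)) γH =
      ∑ᶠ c : ConjClasses ((cmDatum L 3 H').Local v), (finExplicitCollection L H' μ hl hr v).Δ γH (Quotient.out c) *
        classOrbitalIntegral mG ((cmLocalIntegralLevel L 3 H' v : Set ((cmDatum L 3 H').Local v)).indicator fun _ => (1 : ℂ)) c := by
  have hι := endoEmbLocal_eq_glDiagonal_of_fst_eq L v γH hd'
  have hint := endoEmbLocal_mem_cmLocalIntegralLevel_of_nonsplit L w hw hγH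
  have hu : (((isUnit_finGammaTwo L v γH).unit : (UnitaryGroup.LocalRing L v)ˣ) : UnitaryGroup.LocalRing L v) = finGammaTwo L v γH :=
    (isUnit_finGammaTwo L v γH).unit_spec
  have hreg3 := isUnit_vecCons_sub_of_levi ha hb (by rw [hu]; exact h12)
  exact stableOrbitalIntegralRel_indicator_eq_finsum_delta_of_levi_of_nonsplit L H' hH' hH'd w hw hv hH'w hH'i νG
    (finExplicitCollection L H' μ hl hr v) mH hmG hνG hd' hγH hreg ha hb h12 hΦH fun γ₀ _ h₀ =>
      finExplicitDelta_eq_unitModulusChar_of_levi_of_nonsplit L H' hH' hH'd w hw hv hH'w hH'i μ hμ hμω γH hι hreg3 hint ha h₀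

/-- **The three Levi-stratum units from `G`-regularity** (ED. 2 helper for the (N4) assembly): at a NON-SPLIT place `v` (`c • w = w`), for `γ_H = (g, u)` with
`g = diag(d′₀, d′₁)`, `G`-regularity of `γ_H` (★ `IsLocalGRegular`: `ι_v(γ_H) = diag(d′₀, u, d′₁)` has separable characteristic polynomial) gives
`d′₀⁻¹u − 1`, `d′₀⁻¹d′₁ − 1`, `u − d′₁ ∈ (∏_{w∣v} L_w)^×` — the eigenvalues are pairwise distinct in the field `L_w` (Mathlib `Polynomial.separable_prod_X_sub_C_iff`) and
`∏_{w∣v} L_w = L_w` (★ `isUnit_localRing_of_ne_zero_of_subsingleton`).  So the binders `ha`, `hb`, `h12` of the clause above are free on `G`-regular data.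
[cite: Rogawski1990, §4.3 p. 42; §4.9 p. 55] -/
theorem isUnit_levi_of_isLocalGRegular_of_nonsplit (L : Type) [Field L] [NumberField L] [IsCMField L]
    {v : HeightOneSpectrum (𝓞 ↥(maximalRealSubfield L))} (w : PlacesOver L v) (hw : IsCMField.complexConj L • w.1 = w.1)
    {γH : (cmDatum L 2 (Matrix.of fun i j : Fin 2 => if i.val + j.val + 1 = 2 then (1 : L) else 0)).Local v ×
      (cmDatum L 1 (Matrix.of fun i j : Fin 1 => if i.val + j.val + 1 = 1 then (1 : L) else 0)).Local v}
    {d' : Fin 2 → (UnitaryGroup.LocalRing L v)ˣ} (hd' : glDiagonal 2 (UnitaryGroup.LocalRing L v) d' = (γH.1.val : GL (Fin 2) (UnitaryGroup.LocalRing L v)))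
    (hreg : IsLocalGRegular L v γH) :
    IsUnit ((((d' 0)⁻¹ * (isUnit_finGammaTwo L v γH).unit : (UnitaryGroup.LocalRing L v)ˣ) : UnitaryGroup.LocalRing L v) - 1) ∧
      IsUnit ((((d' 0)⁻¹ * d' 1 : (UnitaryGroup.LocalRing L v)ˣ) : UnitaryGroup.LocalRing L v) - 1) ∧
      IsUnit (finGammaTwo L v γH - (d' 1 : UnitaryGroup.LocalRing L v)) := by
  have hvs : Subsingleton (PlacesOver L v) := PlacesOver.subsingleton_of_smul_eq (IsCMField.complexConj L) (IsCMField.complexConj_ne_one L) w hw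
  have hι := endoEmbLocal_eq_glDiagonal_of_fst_eq L v γH hd'
  have hu : (((isUnit_finGammaTwo L v γH).unit : (UnitaryGroup.LocalRing L v)ˣ) : UnitaryGroup.LocalRing L v) = finGammaTwo L v γH :=
    (isUnit_finGammaTwo L v γH).unit_spec
  -- the eigenvalues `d = (d′₀, u, d′₁)` are pairwise distinct at `w`
  have h3 : IsRegularElt ((endoEmbLocal L v γH).val : GL (Fin 3) (UnitaryGroup.LocalRing L v)) := hreg
  rw [isRegularElt_iff, hι, coe_glDiagonal, Matrix.charpoly_diagonal] at h3
  have h3w := h3.map (f := Pi.evalRingHom (fun w' : PlacesOver L v => w'.1.adicCompletion L) w)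
  rw [Polynomial.map_prod] at h3w
  simp only [Polynomial.map_sub, Polynomial.map_X, Polynomial.map_C, Pi.evalRingHom_apply] at h3w
  have hinj := Polynomial.separable_prod_X_sub_C_iff.1 h3w
  have hsub : ∀ i j : Fin 3, i ≠ j →
      IsUnit (((![d' 0, (isUnit_finGammaTwo L v γH).unit, d' 1] i : (UnitaryGroup.LocalRing L v)ˣ) : UnitaryGroup.LocalRing L v) -
        ![d' 0, (isUnit_finGammaTwo L v γH).unit, d' 1] j) := by
    intro i j hij
    refine isUnit_localRing_of_ne_zero_of_subsingleton L v hvs fun h0 => hij (hinj ?_)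
    have h0w := congrFun h0 w
    rw [Pi.sub_apply, Pi.zero_apply, sub_eq_zero] at h0w
    exact h0w
  refine ⟨(HeisRing.isUnit_coe_inv_mul_sub_one_iff ![d' 0, (isUnit_finGammaTwo L v γH).unit, d' 1] 0 1).2 (hsub 1 0 (by decide)),
    (HeisRing.isUnit_coe_inv_mul_sub_one_iff ![d' 0, (isUnit_finGammaTwo L v γH).unit, d' 1] 0 2).2 (hsub 2 0 (by decide)), ?_⟩
  rw [← hu]
  simpa using hsub 1 2 (by decide)

end Literature.NumberTheory.Rogawski1990

end
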